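import Summits.Ventures.CertifiedManyBodySolver.Observables.StiffnessApexTransportDoped
import HarnessLib

/-!
# Ventures/CertifiedManyBodySolver — Observables/StiffnessApexTransportWeightedBracket.lean

HONEST FRAMING: one-sided certified CEILINGS on the uniform flux stiffness (t–t′ f-sum class) at ANY density, transported to a target OFF the apex
curves of two solved sources by BARYCENTRIC INTERPOLATION of the apex hopping at the target; every leaf is CONDITIONAL on the source rows / row
families it names; a ceiling never speaks to the presence of order; not a `T_c` estimate, not a superconductivity verdict; no number of record. Zero
compute, no definition, no claim node, no `sorry`.

Cell `pub/hubbard-fast` (D-0154 (1)(A) «CERTIFICATE REUSE along parameter paths»), seat `hubbard-fast-reuse-2` g3 (`prover-hubbard-fast-reuse-2-g3-0`), path family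
«APEX TRANSPORT», line «APEX-BRACKET»: the REUSE LEMMA in generic form. Companion of hubbard-downfold-unc-2's `Observables/StiffnessApexTransportDopedBracket.lean`
§1 (`ObsStiffnessSeqCeilingAt_of_two_apexSources_of_le_diagHop`: TWO point sources bracketing the target word it with NO `K₂` input on the target class, at the price
`c ≥ max(W₁, W₂)` of the two source words) — sharpened here to the CONVEX COMBINATION `c ≥ μ₁W₁ + μ₂W₂`.

THE POINT. For a target `P = (t′_P, U_P)` and two sources `A_i = (s_i, U_i)`, `0 ≤ U_i < U_P` (the stations may differ), the apex rows
(`Literature/…/HubbardTTPrimeApexRow`: `e_{Φ(1,κ_i,0)}(ω_{A_i}) ≤ e_{Φ(1,κ_i,0)}(ω_P)`, `κ_i = (U_P s_i − U_i t′_P)/(U_P − U_i)` the hopping where the line `P A_i` meets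
`U = 0`) transport EXACTLY the one-body functional at the hopping `κ_i`. The f-sum ceiling at `P` is `−¼e_{Φ(1,2t′_P,0)}(ω_P)` and `κ ↦ e_{Φ(1,κ,0)}(ω_P) = K₁ + κK₂` is AFFINE
(`meanEnergy_hubbardTTPrime_eq_coords`), so for barycentric weights `μ₁, μ₂ ≥ 0`, `μ₁ + μ₂ = 1`, `μ₁κ₁ + μ₂κ₂ = 2t′_P` (they exist iff `P` lies between the two apex
curves, `κ₁ ≤ 2t′_P ≤ κ₂`):

  `e_{Φ(1,2t′_P,0)}(ω_P) = μ₁·e_{Φ(1,κ₁,0)}(ω_P) + μ₂·e_{Φ(1,κ₂,0)}(ω_P) ≥ μ₁·e_{Φ(1,κ₁,0)}(ω_{A₁}) + μ₂·e_{Φ(1,κ₂,0)}(ω_{A₂}) ≥ μ₁ℓ₁ + μ₂ℓ₂`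

for ANY certified floors `ℓ_i` on the source classes at the hoppings `κ_i` — hence `ObsStiffnessSeqCeilingAt t′_P U_P n c` for `c ≥ −(μ₁ℓ₁ + μ₂ℓ₂)/4`. The interpolation
happens AT THE TARGET, so nothing is asked of the target class; the companion's `max` is the special case «both floors at the worse value».

* §1 `ObsStiffnessSeqCeilingAt_of_two_apexSources_weighted` — functional master (floors `ℓ_i` of any provenance);
* §2 the floors in the shapes the tree delivers: (a) an orbit-lower family for the END objective `−X₀(σ_i)` at the slot `2σ_i = κ_i` (target-slot reads, σ-chords of two
  end objectives — lever zero), (b) the source's OWN f-sum orbit-lower family at `σ = s_i` plus a `K₂` FLOOR `B_i` on the class with the floor orientation `2s_i ≤ κ_i`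
  (`e_{κ_i} ≥ e_{2s_i} + (κ_i − 2s_i)B_i`); corollaries «slot × slot» (`…_weighted_of_slot_slot`), «slot × own-word-and-floor» (`…_weighted_of_slot_fsumFloor`), «own × own»
  (`…_weighted_of_fsumFloor_fsumFloor` — the weighted edition of the companion's theorem, `W_i = −r_i − (κ_i − 2s_i)B_i/4`);
* §3 arithmetic: the weighted word never exceeds the companion's `max` (`weighted_le_max`), and the weights of a bracketed target (`bracket_weights`).

NOT said: nothing flows toward `U < U_i`; outside the bracket (`2t′_P < κ₁` or `> κ₂` for every available pair) a `K₂` word on the TARGET class is still needed; the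
quality is set by the two source words and by how close `2t′_P` sits to the cheaper `κ_i`; `λ ≠ 0` words are not of this form; no `T > 0`.

References: T. Koma, H. Tasaki, J. Stat. Phys. 76 (1994) 745, §1 [KomaTasaki1994]; D. J. Scalapino, S. R. White, S.-C. Zhang, PRB 47 (1993) 7995, §II
[ScalapinoWhiteZhang1993]; T. Hazra, N. Verma, M. Randeria, PRX 9 (2019) 031049, eq. (4) [HazraVermaRanderia2019].
-/

noncomputable section

namespace Summit.Ventures.CertifiedManyBodySolver.Observables

open Literature.MathematicalPhysics.QuantumLattice
open Literature.MathematicalPhysics.QuantumLattice.ThermodynamicLimit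
open Literature.MathematicalPhysics.QuantumFieldTheory
open Literature.Probability.LatticeModels
open Matrix Finset Filter Topology HubbardWave0
open scoped Matrix BigOperators ComplexOrder

/-! ## §1 The functional master: two apex rows, barycentric weights at the target -/

section Master

variable {t'P UP n s₁ U₁ s₂ U₂ : ℝ}

/-- **WEIGHTED TWO-SOURCE APEX BRACKET (any density, functional form).** Target `(t′_P, U_P)`, density `0 ≤ n < 2`; sources `(s_i, U_i)` with
`0 ≤ U_i < U_P` and apex hoppings `κ_i = (U_P s_i − U_i t′_P)/(U_P − U_i)`; weights `μ₁, μ₂ ≥ 0`, `μ₁ + μ₂ = 1`, `μ₁κ₁ + μ₂κ₂ = 2t′_P`. If `ℓ_i ≤ e_{Φ(1,κ_i,0)}(ω)`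
for every torus limit `ω` of unit `(rectN n L, S^z = 0)`-sector ground states of `hubbardTorusTT' L 1 s_i U_i` (`i = 1, 2`), then `ObsStiffnessSeqCeilingAt t′_P U_P n c`
for every rational `c ≥ −(μ₁ℓ₁ + μ₂ℓ₂)/4`: the one-body functional is affine in the hopping, the two apex rows bound its values at `κ₁, κ₂` on the target
class from below by the source floors. [cite: KomaTasaki1994, §1] [cite: ScalapinoWhiteZhang1993, §II] [cite: HazraVermaRanderia2019, eq. (4)] -/
theorem ObsStiffnessSeqCeilingAt_of_two_apexSources_weighted (hU₁0 : 0 ≤ U₁) (hU₁ : U₁ < UP) (hU₂0 : 0 ≤ U₂) (hU₂ : U₂ < UP)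
    (hn0 : 0 ≤ n) (hn2 : n < 2) {μ₁ μ₂ : ℝ} (hμ₁ : 0 ≤ μ₁) (hμ₂ : 0 ≤ μ₂) (hμ : μ₁ + μ₂ = 1)
    (hκ : μ₁ * ((UP * s₁ - U₁ * t'P) / (UP - U₁)) + μ₂ * ((UP * s₂ - U₂ * t'P) / (UP - U₂)) = 2 * t'P) {ℓ₁ ℓ₂ : ℝ}
    (h₁ : ∀ (ω : InfVolFermionState 2) (Ls : ℕ → ℕ) (ψ : ∀ L, Fock (Orb (FermionTorus 2 L))),
      Tendsto Ls atTop atTop →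
      (∀ j, IsGroundStateInSector (hubbardTorusTT' (Ls j) 1 s₁ U₁) (rectN n (Ls j)) 0 (ψ (Ls j))) →
      (∀ j, star (ψ (Ls j)) ⬝ᵥ ψ (Ls j) = 1) → ω.IsTorusLimitOf ψ Ls →
      ℓ₁ ≤ ω.meanEnergy (hubbardTTPrimeFermionInteraction 1 ((UP * s₁ - U₁ * t'P) / (UP - U₁)) 0) 1)
    (h₂ : ∀ (ω : InfVolFermionState 2) (Ls : ℕ → ℕ) (ψ : ∀ L, Fock (Orb (FermionTorus 2 L))),
      Tendsto Ls atTop atTop →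
      (∀ j, IsGroundStateInSector (hubbardTorusTT' (Ls j) 1 s₂ U₂) (rectN n (Ls j)) 0 (ψ (Ls j))) →
      (∀ j, star (ψ (Ls j)) ⬝ᵥ ψ (Ls j) = 1) → ω.IsTorusLimitOf ψ Ls →
      ℓ₂ ≤ ω.meanEnergy (hubbardTTPrimeFermionInteraction 1 ((UP * s₂ - U₂ * t'P) / (UP - U₂)) 0) 1)
    (c : ℚ) (hc : -(μ₁ * ℓ₁ + μ₂ * ℓ₂) / 4 ≤ ((c : ℚ) : ℝ)) :
    ObsStiffnessSeqCeilingAt t'P UP n c := by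
  intro ρs θ₀ _ hθ₀ Ls hLs hst
  refine fluxStiffness_le_of_torusLimitTT'_oddMoment_orbit_certificate_seq t'P (U := UP) (δ := 1 - n) (q := ((c : ℚ) : ℝ)) 0
    Finset.univ Finset.univ_nonempty (by linarith) (by linarith) hθ₀ hLs hst ?_
  intro ω Ms ψ hMs hψ h1 hω
  have hψ' : ∀ j, IsGroundStateInSector (hubbardTorusTT' (Ms j) 1 t'P UP) (rectN n (Ms j)) 0 (ψ (Ms j)) := fun j => by
    simpa only [sub_sub_cancel] using hψ j
  rw [orbitMean_rotOddMomentLimitFunctionalTT_lam_zero_eq_meanEnergy_twice_tPrime hω.isTranslationInvariant]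
  obtain ⟨φ₁, g₁, ω₁, hg₁, hφ₁, hφ₁1, hω₁, -, -, -⟩ :=
    exists_isTorusLimitOf_sectorGroundState_TT' 1 s₁ U₁ hn0 hn2.le (Ls := id) tendsto_id
  obtain ⟨φ₂, g₂, ω₂, hg₂, hφ₂, hφ₂1, hω₂, -, -, -⟩ :=
    exists_isTorusLimitOf_sectorGroundState_TT' 1 s₂ U₂ hn0 hn2.le (Ls := id) tendsto_id
  have hL₁ : Tendsto (id ∘ g₁ : ℕ → ℕ) atTop atTop := tendsto_id.comp hg₁.tendsto_atTop
  have hL₂ : Tendsto (id ∘ g₂ : ℕ → ℕ) atTop atTop := tendsto_id.comp hg₂.tendsto_atTop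
  -- the two apex rows, source → target, at the hoppings `κ₁`, `κ₂`
  have hapx₁ := InfVolFermionState.IsTorusLimitOf.meanEnergy_apexHopping_le_of_groundStates 1 s₁ t'P hU₁0 hU₁ hn0 hn2
    hω₁ hL₁ (fun j => hφ₁ _) (fun j => hφ₁1 _) hω hMs hψ' h1
  have hapx₂ := InfVolFermionState.IsTorusLimitOf.meanEnergy_apexHopping_le_of_groundStates 1 s₂ t'P hU₂0 hU₂ hn0 hn2
    hω₂ hL₂ (fun j => hφ₂ _) (fun j => hφ₂1 _) hω hMs hψ' h1
  -- the two source floors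
  have hl₁ := h₁ ω₁ (id ∘ g₁) φ₁ hL₁ (fun j => hφ₁ _) (fun j => hφ₁1 _) hω₁
  have hl₂ := h₂ ω₂ (id ∘ g₂) φ₂ hL₂ (fun j => hφ₂ _) (fun j => hφ₂1 _) hω₂
  -- the one-body functional of the TARGET state is affine in the hopping
  set κ₁ : ℝ := (UP * s₁ - U₁ * t'P) / (UP - U₁) with hκ₁
  set κ₂ : ℝ := (UP * s₂ - U₂ * t'P) / (UP - U₂) with hκ₂
  have e₁ := ω.meanEnergy_hubbardTTPrime_eq_coords 1 κ₁ 0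
  have e₂ := ω.meanEnergy_hubbardTTPrime_eq_coords 1 κ₂ 0
  have eP := ω.meanEnergy_hubbardTTPrime_eq_coords 1 (2 * t'P) 0
  have haff : ω.meanEnergy (hubbardTTPrimeFermionInteraction 1 (2 * t'P) 0) 1 =
      μ₁ * ω.meanEnergy (hubbardTTPrimeFermionInteraction 1 κ₁ 0) 1 +
        μ₂ * ω.meanEnergy (hubbardTTPrimeFermionInteraction 1 κ₂ 0) 1 := by
    rw [e₁, e₂, eP, ← hκ]
    linear_combination (ω.meanEnergy (hubbardTTPrimeFermionInteraction 1 0 0) 1) * hμ.symm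
  have hw₁ := mul_le_mul_of_nonneg_left (hl₁.trans hapx₁) hμ₁
  have hw₂ := mul_le_mul_of_nonneg_left (hl₂.trans hapx₂) hμ₂
  have hc' : -(μ₁ * ℓ₁ + μ₂ * ℓ₂) / 4 ≤ ((c : ℚ) : ℝ) := hc
  rw [haff]
  linarith

end Master

/-! ## §2 The floors in the shapes the tree delivers -/

section Shapes

variable {t'P UP n s₁ U₁ s₂ U₂ : ℝ}

/-- **Slot floor ⇒ hopping floor.** An unconditional orbit-lower family `v ≤ |D₄|⁻¹Σ_γ Re ω_γ(−X₀(σ, Uo))` on a class, with `2σ = κ`, is the floor `4v ≤ e_{Φ(1,κ,0)}(ω)`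
on that class (orbit dictionary `orbitMean_re_expect_neg_oddMomentTT_lam_zero`). [cite: HazraVermaRanderia2019, eq. (4)] -/
theorem hoppingFloor_of_slot_orbitLower {s U σ κ : ℝ} (Uo v : ℝ) (hσ : 2 * σ = κ)
    (h : ∀ (ω : InfVolFermionState 2) (Ls : ℕ → ℕ) (ψ : ∀ L, Fock (Orb (FermionTorus 2 L))),
      Tendsto Ls atTop atTop →
      (∀ j, IsGroundStateInSector (hubbardTorusTT' (Ls j) 1 s U) (rectN n (Ls j)) 0 (ψ (Ls j))) →
      (∀ j, star (ψ (Ls j)) ⬝ᵥ ψ (Ls j) = 1) → ω.IsTorusLimitOf ψ Ls →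
      v ≤ ((Finset.univ : Finset (DihedralGroup 4)).card : ℝ)⁻¹ * ∑ g ∈ (Finset.univ : Finset (DihedralGroup 4)),
        (ω.expect (d4ShiftSet g 0 (box 2 7)) (fermionEmbed (PolySite.d4Emb g 0 (box 2 7)) (-oddMomentObsTT σ Uo 0))).re) :
    ∀ (ω : InfVolFermionState 2) (Ls : ℕ → ℕ) (ψ : ∀ L, Fock (Orb (FermionTorus 2 L))),
      Tendsto Ls atTop atTop →
      (∀ j, IsGroundStateInSector (hubbardTorusTT' (Ls j) 1 s U) (rectN n (Ls j)) 0 (ψ (Ls j))) →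
      (∀ j, star (ψ (Ls j)) ⬝ᵥ ψ (Ls j) = 1) → ω.IsTorusLimitOf ψ Ls →
      4 * v ≤ ω.meanEnergy (hubbardTTPrimeFermionInteraction 1 κ 0) 1 := by
  intro ω Ls ψ hLs hψ h1 hω
  have hv := h ω Ls ψ hLs hψ h1 hω
  rw [orbitMean_re_expect_neg_oddMomentTT_lam_zero hω.isTranslationInvariant, hσ] at hv
  linarith

/-- **Own word + `K₂` floor ⇒ hopping floor.** An unconditional orbit-lower family `v ≤ |D₄|⁻¹Σ_γ Re ω_γ(−X₀(s, Uo))` at the class's OWN slot `s` and a floor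
`B ≤ K₂(ω)` on the class give, for every hopping `κ ≥ 2s`, the floor `4v + (κ − 2s)B ≤ e_{Φ(1,κ,0)}(ω)` on that class
(`meanEnergy_hopping_add_mul_le_of_le_diagHop`). [cite: HazraVermaRanderia2019, eq. (4)] [cite: KomaTasaki1994, §1] -/
theorem hoppingFloor_of_ownSlot_orbitLower_of_le_diagHop {s U κ : ℝ} (Uo v : ℝ) (hκ : 2 * s ≤ κ)
    (h : ∀ (ω : InfVolFermionState 2) (Ls : ℕ → ℕ) (ψ : ∀ L, Fock (Orb (FermionTorus 2 L))),
      Tendsto Ls atTop atTop →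
      (∀ j, IsGroundStateInSector (hubbardTorusTT' (Ls j) 1 s U) (rectN n (Ls j)) 0 (ψ (Ls j))) →
      (∀ j, star (ψ (Ls j)) ⬝ᵥ ψ (Ls j) = 1) → ω.IsTorusLimitOf ψ Ls →
      v ≤ ((Finset.univ : Finset (DihedralGroup 4)).card : ℝ)⁻¹ * ∑ g ∈ (Finset.univ : Finset (DihedralGroup 4)),
        (ω.expect (d4ShiftSet g 0 (box 2 7)) (fermionEmbed (PolySite.d4Emb g 0 (box 2 7)) (-oddMomentObsTT s Uo 0))).re)
    {B : ℝ}
    (hB : ∀ (ω : InfVolFermionState 2) (Ls : ℕ → ℕ) (ψ : ∀ L, Fock (Orb (FermionTorus 2 L))),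
      Tendsto Ls atTop atTop →
      (∀ j, IsGroundStateInSector (hubbardTorusTT' (Ls j) 1 s U) (rectN n (Ls j)) 0 (ψ (Ls j))) →
      (∀ j, star (ψ (Ls j)) ⬝ᵥ ψ (Ls j) = 1) → ω.IsTorusLimitOf ψ Ls →
      B ≤ ω.meanEnergy (hubbardTTPrimeFermionInteraction 0 1 0) 1) :
    ∀ (ω : InfVolFermionState 2) (Ls : ℕ → ℕ) (ψ : ∀ L, Fock (Orb (FermionTorus 2 L))),
      Tendsto Ls atTop atTop →
      (∀ j, IsGroundStateInSector (hubbardTorusTT' (Ls j) 1 s U) (rectN n (Ls j)) 0 (ψ (Ls j))) →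
      (∀ j, star (ψ (Ls j)) ⬝ᵥ ψ (Ls j) = 1) → ω.IsTorusLimitOf ψ Ls →
      4 * v + (κ - 2 * s) * B ≤ ω.meanEnergy (hubbardTTPrimeFermionInteraction 1 κ 0) 1 := by
  intro ω Ls ψ hLs hψ h1 hω
  have hv := h ω Ls ψ hLs hψ h1 hω
  rw [orbitMean_re_expect_neg_oddMomentTT_lam_zero hω.isTranslationInvariant] at hv
  have hcmp := InfVolFermionState.meanEnergy_hopping_add_mul_le_of_le_diagHop ω 1 (κ := 2 * s) (κ' := κ) hκ
    (hB ω Ls ψ hLs hψ h1 hω)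
  linarith

/-- **A certified f-sum orbit ROW under a certified cap is an unconditional orbit-lower family** (the registry shape `SquareTTPrimeCorrOrbitLowerRow … u r … (−X₀(σ))`
with `e₀ ≤ u` discharged). [cite: BoydVandenberghe2004, §5.9] -/
theorem orbitLower_of_orbitLowerRow {s U σ : ℝ} (Uo : ℝ) {u r : ℚ}
    (hrow : SquareTTPrimeCorrOrbitLowerRow s U n u r Finset.univ (box 2 7) (-oddMomentObsTT σ Uo 0))
    (hu : energyDensityTT' 1 s U n ≤ ((u : ℚ) : ℝ)) :
    ∀ (ω : InfVolFermionState 2) (Ls : ℕ → ℕ) (ψ : ∀ L, Fock (Orb (FermionTorus 2 L))),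
      Tendsto Ls atTop atTop →
      (∀ j, IsGroundStateInSector (hubbardTorusTT' (Ls j) 1 s U) (rectN n (Ls j)) 0 (ψ (Ls j))) →
      (∀ j, star (ψ (Ls j)) ⬝ᵥ ψ (Ls j) = 1) → ω.IsTorusLimitOf ψ Ls →
      ((r : ℚ) : ℝ) ≤ ((Finset.univ : Finset (DihedralGroup 4)).card : ℝ)⁻¹ * ∑ g ∈ (Finset.univ : Finset (DihedralGroup 4)),
        (ω.expect (d4ShiftSet g 0 (box 2 7)) (fermionEmbed (PolySite.d4Emb g 0 (box 2 7)) (-oddMomentObsTT σ Uo 0))).re :=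
  fun ω Ls ψ hLs hψ h1 hω => hrow ω Ls ψ hLs hψ h1 hω hu

/-- **WEIGHTED BRACKET, «slot × slot» edition.** Both source floors are orbit-lower families for END objectives: `v_i ≤ |D₄|⁻¹Σ_γ Re ω_γ(−X₀(σ_i, Uo_i))` on the class
`(s_i, U_i, n)` with `2σ_i = κ_i` (a target-slot read, or the σ-chord of two end objectives on one class). Then `ObsStiffnessSeqCeilingAt t′_P U_P n c` for every
`c ≥ μ₁(−v₁) + μ₂(−v₂)`. Lever zero on both sides. [cite: KomaTasaki1994, §1] [cite: ScalapinoWhiteZhang1993, §II] -/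
theorem ObsStiffnessSeqCeilingAt_of_two_apexSources_weighted_of_slot_slot (Uo₁ Uo₂ : ℝ) (hU₁0 : 0 ≤ U₁) (hU₁ : U₁ < UP)
    (hU₂0 : 0 ≤ U₂) (hU₂ : U₂ < UP) (hn0 : 0 ≤ n) (hn2 : n < 2) {μ₁ μ₂ : ℝ} (hμ₁ : 0 ≤ μ₁) (hμ₂ : 0 ≤ μ₂) (hμ : μ₁ + μ₂ = 1)
    (hκ : μ₁ * ((UP * s₁ - U₁ * t'P) / (UP - U₁)) + μ₂ * ((UP * s₂ - U₂ * t'P) / (UP - U₂)) = 2 * t'P) {σ₁ σ₂ : ℝ}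
    (hσ₁ : 2 * σ₁ = (UP * s₁ - U₁ * t'P) / (UP - U₁)) (hσ₂ : 2 * σ₂ = (UP * s₂ - U₂ * t'P) / (UP - U₂)) {v₁ v₂ : ℝ}
    (h₁ : ∀ (ω : InfVolFermionState 2) (Ls : ℕ → ℕ) (ψ : ∀ L, Fock (Orb (FermionTorus 2 L))),
      Tendsto Ls atTop atTop →
      (∀ j, IsGroundStateInSector (hubbardTorusTT' (Ls j) 1 s₁ U₁) (rectN n (Ls j)) 0 (ψ (Ls j))) →
      (∀ j, star (ψ (Ls j)) ⬝ᵥ ψ (Ls j) = 1) → ω.IsTorusLimitOf ψ Ls →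
      v₁ ≤ ((Finset.univ : Finset (DihedralGroup 4)).card : ℝ)⁻¹ * ∑ g ∈ (Finset.univ : Finset (DihedralGroup 4)),
        (ω.expect (d4ShiftSet g 0 (box 2 7)) (fermionEmbed (PolySite.d4Emb g 0 (box 2 7)) (-oddMomentObsTT σ₁ Uo₁ 0))).re)
    (h₂ : ∀ (ω : InfVolFermionState 2) (Ls : ℕ → ℕ) (ψ : ∀ L, Fock (Orb (FermionTorus 2 L))),
      Tendsto Ls atTop atTop →
      (∀ j, IsGroundStateInSector (hubbardTorusTT' (Ls j) 1 s₂ U₂) (rectN n (Ls j)) 0 (ψ (Ls j))) →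
      (∀ j, star (ψ (Ls j)) ⬝ᵥ ψ (Ls j) = 1) → ω.IsTorusLimitOf ψ Ls →
      v₂ ≤ ((Finset.univ : Finset (DihedralGroup 4)).card : ℝ)⁻¹ * ∑ g ∈ (Finset.univ : Finset (DihedralGroup 4)),
        (ω.expect (d4ShiftSet g 0 (box 2 7)) (fermionEmbed (PolySite.d4Emb g 0 (box 2 7)) (-oddMomentObsTT σ₂ Uo₂ 0))).re)
    (c : ℚ) (hc : μ₁ * (-v₁) + μ₂ * (-v₂) ≤ ((c : ℚ) : ℝ)) :
    ObsStiffnessSeqCeilingAt t'P UP n c :=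
  ObsStiffnessSeqCeilingAt_of_two_apexSources_weighted hU₁0 hU₁ hU₂0 hU₂ hn0 hn2 hμ₁ hμ₂ hμ hκ
    (hoppingFloor_of_slot_orbitLower Uo₁ v₁ hσ₁ h₁) (hoppingFloor_of_slot_orbitLower Uo₂ v₂ hσ₂ h₂) c (by linarith)

/-- **WEIGHTED BRACKET, «slot × own-word-and-floor» edition.** Left floor = an orbit-lower family for the END objective `−X₀(σ₁, Uo₁)` on the class `(s₁, U₁, n)` with
`2σ₁ = κ₁` (lever zero); right floor = the class `(s₂, U₂, n)`'s OWN f-sum orbit-lower family `v₂` at the slot `s₂` plus a floor `B₂ ≤ K₂` on it, floor orientation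
`2s₂ ≤ κ₂` (i.e. `2s₂(U_P − U₂) ≤ U_P s₂ − U₂ t′_P`). Then `ObsStiffnessSeqCeilingAt t′_P U_P n c` for every `c ≥ μ₁(−v₁) + μ₂(−v₂ − (κ₂ − 2s₂)B₂/4)`.
[cite: KomaTasaki1994, §1] [cite: ScalapinoWhiteZhang1993, §II] -/
theorem ObsStiffnessSeqCeilingAt_of_two_apexSources_weighted_of_slot_fsumFloor (Uo₁ Uo₂ : ℝ) (hU₁0 : 0 ≤ U₁) (hU₁ : U₁ < UP)
    (hU₂0 : 0 ≤ U₂) (hU₂ : U₂ < UP) (hn0 : 0 ≤ n) (hn2 : n < 2) {μ₁ μ₂ : ℝ} (hμ₁ : 0 ≤ μ₁) (hμ₂ : 0 ≤ μ₂) (hμ : μ₁ + μ₂ = 1)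
    (hκ : μ₁ * ((UP * s₁ - U₁ * t'P) / (UP - U₁)) + μ₂ * ((UP * s₂ - U₂ * t'P) / (UP - U₂)) = 2 * t'P) {σ₁ : ℝ}
    (hσ₁ : 2 * σ₁ = (UP * s₁ - U₁ * t'P) / (UP - U₁)) (h2s₂ : 2 * s₂ ≤ (UP * s₂ - U₂ * t'P) / (UP - U₂)) {v₁ v₂ : ℝ}
    (h₁ : ∀ (ω : InfVolFermionState 2) (Ls : ℕ → ℕ) (ψ : ∀ L, Fock (Orb (FermionTorus 2 L))),
      Tendsto Ls atTop atTop →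
      (∀ j, IsGroundStateInSector (hubbardTorusTT' (Ls j) 1 s₁ U₁) (rectN n (Ls j)) 0 (ψ (Ls j))) →
      (∀ j, star (ψ (Ls j)) ⬝ᵥ ψ (Ls j) = 1) → ω.IsTorusLimitOf ψ Ls →
      v₁ ≤ ((Finset.univ : Finset (DihedralGroup 4)).card : ℝ)⁻¹ * ∑ g ∈ (Finset.univ : Finset (DihedralGroup 4)),
        (ω.expect (d4ShiftSet g 0 (box 2 7)) (fermionEmbed (PolySite.d4Emb g 0 (box 2 7)) (-oddMomentObsTT σ₁ Uo₁ 0))).re)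
    (h₂ : ∀ (ω : InfVolFermionState 2) (Ls : ℕ → ℕ) (ψ : ∀ L, Fock (Orb (FermionTorus 2 L))),
      Tendsto Ls atTop atTop →
      (∀ j, IsGroundStateInSector (hubbardTorusTT' (Ls j) 1 s₂ U₂) (rectN n (Ls j)) 0 (ψ (Ls j))) →
      (∀ j, star (ψ (Ls j)) ⬝ᵥ ψ (Ls j) = 1) → ω.IsTorusLimitOf ψ Ls →
      v₂ ≤ ((Finset.univ : Finset (DihedralGroup 4)).card : ℝ)⁻¹ * ∑ g ∈ (Finset.univ : Finset (DihedralGroup 4)),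
        (ω.expect (d4ShiftSet g 0 (box 2 7)) (fermionEmbed (PolySite.d4Emb g 0 (box 2 7)) (-oddMomentObsTT s₂ Uo₂ 0))).re)
    {B₂ : ℝ}
    (hB₂ : ∀ (ω : InfVolFermionState 2) (Ls : ℕ → ℕ) (ψ : ∀ L, Fock (Orb (FermionTorus 2 L))),
      Tendsto Ls atTop atTop →
      (∀ j, IsGroundStateInSector (hubbardTorusTT' (Ls j) 1 s₂ U₂) (rectN n (Ls j)) 0 (ψ (Ls j))) →
      (∀ j, star (ψ (Ls j)) ⬝ᵥ ψ (Ls j) = 1) → ω.IsTorusLimitOf ψ Ls →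
      B₂ ≤ ω.meanEnergy (hubbardTTPrimeFermionInteraction 0 1 0) 1)
    (c : ℚ) (hc : μ₁ * (-v₁) + μ₂ * (-v₂ - ((UP * s₂ - U₂ * t'P) / (UP - U₂) - 2 * s₂) * B₂ / 4) ≤ ((c : ℚ) : ℝ)) :
    ObsStiffnessSeqCeilingAt t'P UP n c :=
  ObsStiffnessSeqCeilingAt_of_two_apexSources_weighted hU₁0 hU₁ hU₂0 hU₂ hn0 hn2 hμ₁ hμ₂ hμ hκ
    (hoppingFloor_of_slot_orbitLower Uo₁ v₁ hσ₁ h₁) (hoppingFloor_of_ownSlot_orbitLower_of_le_diagHop Uo₂ v₂ h2s₂ h₂ hB₂) c (by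
      have e : -(μ₁ * (4 * v₁) + μ₂ * (4 * v₂ + ((UP * s₂ - U₂ * t'P) / (UP - U₂) - 2 * s₂) * B₂)) / 4 =
          μ₁ * (-v₁) + μ₂ * (-v₂ - ((UP * s₂ - U₂ * t'P) / (UP - U₂) - 2 * s₂) * B₂ / 4) := by ring
      rw [e]; exact hc)

/-- **WEIGHTED BRACKET, «own × own» edition** — the weighted form of the companion's `ObsStiffnessSeqCeilingAt_of_two_apexSources_of_le_diagHop`: two certified f-sum orbit rows
`r_i` (caps `u_i`) at `(s_i, U_i, n)` with floors `B_i ≤ K₂` on their classes and the floor orientations `2s_i ≤ κ_i`; then `ObsStiffnessSeqCeilingAt t′_P U_P n c` for every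
`c ≥ μ₁W₁ + μ₂W₂`, `W_i = −r_i − (κ_i − 2s_i)B_i/4` (the companion asks `c ≥ max(W₁, W₂)`). [cite: KomaTasaki1994, §1] [cite: ScalapinoWhiteZhang1993, §II] -/
theorem ObsStiffnessSeqCeilingAt_of_two_apexSources_weighted_of_fsumFloor_fsumFloor (Uo₁ Uo₂ : ℝ) (hU₁0 : 0 ≤ U₁) (hU₁ : U₁ < UP)
    (hU₂0 : 0 ≤ U₂) (hU₂ : U₂ < UP) (hn0 : 0 ≤ n) (hn2 : n < 2) {μ₁ μ₂ : ℝ} (hμ₁ : 0 ≤ μ₁) (hμ₂ : 0 ≤ μ₂) (hμ : μ₁ + μ₂ = 1)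
    (hκ : μ₁ * ((UP * s₁ - U₁ * t'P) / (UP - U₁)) + μ₂ * ((UP * s₂ - U₂ * t'P) / (UP - U₂)) = 2 * t'P)
    (h2s₁ : 2 * s₁ ≤ (UP * s₁ - U₁ * t'P) / (UP - U₁)) (h2s₂ : 2 * s₂ ≤ (UP * s₂ - U₂ * t'P) / (UP - U₂)) {u₁ r₁ u₂ r₂ : ℚ}
    (hrow₁ : SquareTTPrimeCorrOrbitLowerRow s₁ U₁ n u₁ r₁ Finset.univ (box 2 7) (-oddMomentObsTT s₁ Uo₁ 0))
    (hu₁ : energyDensityTT' 1 s₁ U₁ n ≤ ((u₁ : ℚ) : ℝ))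
    (hrow₂ : SquareTTPrimeCorrOrbitLowerRow s₂ U₂ n u₂ r₂ Finset.univ (box 2 7) (-oddMomentObsTT s₂ Uo₂ 0))
    (hu₂ : energyDensityTT' 1 s₂ U₂ n ≤ ((u₂ : ℚ) : ℝ)) {B₁ B₂ : ℝ}
    (hB₁ : ∀ (ω : InfVolFermionState 2) (Ls : ℕ → ℕ) (ψ : ∀ L, Fock (Orb (FermionTorus 2 L))),
      Tendsto Ls atTop atTop →
      (∀ j, IsGroundStateInSector (hubbardTorusTT' (Ls j) 1 s₁ U₁) (rectN n (Ls j)) 0 (ψ (Ls j))) →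
      (∀ j, star (ψ (Ls j)) ⬝ᵥ ψ (Ls j) = 1) → ω.IsTorusLimitOf ψ Ls →
      B₁ ≤ ω.meanEnergy (hubbardTTPrimeFermionInteraction 0 1 0) 1)
    (hB₂ : ∀ (ω : InfVolFermionState 2) (Ls : ℕ → ℕ) (ψ : ∀ L, Fock (Orb (FermionTorus 2 L))),
      Tendsto Ls atTop atTop →
      (∀ j, IsGroundStateInSector (hubbardTorusTT' (Ls j) 1 s₂ U₂) (rectN n (Ls j)) 0 (ψ (Ls j))) →
      (∀ j, star (ψ (Ls j)) ⬝ᵥ ψ (Ls j) = 1) → ω.IsTorusLimitOf ψ Ls →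
      B₂ ≤ ω.meanEnergy (hubbardTTPrimeFermionInteraction 0 1 0) 1)
    (c : ℚ) (hc : μ₁ * (-((r₁ : ℚ) : ℝ) - ((UP * s₁ - U₁ * t'P) / (UP - U₁) - 2 * s₁) * B₁ / 4) +
      μ₂ * (-((r₂ : ℚ) : ℝ) - ((UP * s₂ - U₂ * t'P) / (UP - U₂) - 2 * s₂) * B₂ / 4) ≤ ((c : ℚ) : ℝ)) :
    ObsStiffnessSeqCeilingAt t'P UP n c :=
  ObsStiffnessSeqCeilingAt_of_two_apexSources_weighted hU₁0 hU₁ hU₂0 hU₂ hn0 hn2 hμ₁ hμ₂ hμ hκ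
    (hoppingFloor_of_ownSlot_orbitLower_of_le_diagHop Uo₁ ((r₁ : ℚ) : ℝ) h2s₁ (orbitLower_of_orbitLowerRow Uo₁ hrow₁ hu₁) hB₁)
    (hoppingFloor_of_ownSlot_orbitLower_of_le_diagHop Uo₂ ((r₂ : ℚ) : ℝ) h2s₂ (orbitLower_of_orbitLowerRow Uo₂ hrow₂ hu₂) hB₂) c (by
      have e : -(μ₁ * (4 * ((r₁ : ℚ) : ℝ) + ((UP * s₁ - U₁ * t'P) / (UP - U₁) - 2 * s₁) * B₁) +
            μ₂ * (4 * ((r₂ : ℚ) : ℝ) + ((UP * s₂ - U₂ * t'P) / (UP - U₂) - 2 * s₂) * B₂)) / 4 =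
          μ₁ * (-((r₁ : ℚ) : ℝ) - ((UP * s₁ - U₁ * t'P) / (UP - U₁) - 2 * s₁) * B₁ / 4) +
            μ₂ * (-((r₂ : ℚ) : ℝ) - ((UP * s₂ - U₂ * t'P) / (UP - U₂) - 2 * s₂) * B₂ / 4) := by ring
      rw [e]; exact hc)

end Shapes

/-! ## §3 Arithmetic: the weights of a bracketed target; weighted ≤ max -/

/-- **The barycentric weights of a bracketed hopping.** If `κ₁ < κ₂` and `κ₁ ≤ τ ≤ κ₂` then `μ₁ = (κ₂ − τ)/(κ₂ − κ₁)`, `μ₂ = (τ − κ₁)/(κ₂ − κ₁)` are `≥ 0`, sum to `1` and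
`μ₁κ₁ + μ₂κ₂ = τ`. [folklore] -/
theorem bracket_weights {κ₁ κ₂ τ : ℝ} (hκ : κ₁ < κ₂) (h₁ : κ₁ ≤ τ) (h₂ : τ ≤ κ₂) :
    0 ≤ (κ₂ - τ) / (κ₂ - κ₁) ∧ 0 ≤ (τ - κ₁) / (κ₂ - κ₁) ∧ (κ₂ - τ) / (κ₂ - κ₁) + (τ - κ₁) / (κ₂ - κ₁) = 1 ∧
      (κ₂ - τ) / (κ₂ - κ₁) * κ₁ + (τ - κ₁) / (κ₂ - κ₁) * κ₂ = τ := by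
  have hd : 0 < κ₂ - κ₁ := sub_pos.2 hκ
  refine ⟨div_nonneg (by linarith) hd.le, div_nonneg (by linarith) hd.le, ?_, ?_⟩
  · field_simp; ring
  · field_simp; ring

/-- **Weighted never exceeds max**: for `μ₁, μ₂ ≥ 0`, `μ₁ + μ₂ = 1`, `μ₁W₁ + μ₂W₂ ≤ max W₁ W₂` — the weighted bracket dominates the companion's `max` edition pointwise. [folklore] -/
theorem weighted_le_max {μ₁ μ₂ W₁ W₂ : ℝ} (hμ₁ : 0 ≤ μ₁) (hμ₂ : 0 ≤ μ₂) (hμ : μ₁ + μ₂ = 1) :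
    μ₁ * W₁ + μ₂ * W₂ ≤ max W₁ W₂ := by
  have h₁ := mul_le_mul_of_nonneg_left (le_max_left W₁ W₂) hμ₁
  have h₂ := mul_le_mul_of_nonneg_left (le_max_right W₁ W₂) hμ₂
  calc μ₁ * W₁ + μ₂ * W₂ ≤ μ₁ * max W₁ W₂ + μ₂ * max W₁ W₂ := add_le_add h₁ h₂
    _ = max W₁ W₂ := by rw [← add_mul, hμ, one_mul]

/-! ## §4 (append, same seat, same session) The CEILING orientation: a source used BEYOND its own slot (`κ ≤ 2s`) -/

section CeilingOrientation

variable {t'P UP n s₁ U₁ s₂ U₂ : ℝ}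

/-- **Own word + `K₂` CEILING ⇒ hopping floor for `κ ≤ 2s`.** An unconditional orbit-lower family `v ≤ |D₄|⁻¹Σ_γ Re ω_γ(−X₀(s, Uo))` at the class's OWN slot `s` and a
CEILING `K₂(ω) ≤ A` on the class give, for every hopping `κ ≤ 2s`, the floor `4v + (κ − 2s)A ≤ e_{Φ(1,κ,0)}(ω)` (`meanEnergy_hopping_le_add_mul_of_diagHop_le`; the price
`(2s − κ)A` is what a target LEFT of the line of apex hopping `2s` through the source costs). [cite: HazraVermaRanderia2019, eq. (4)] [cite: KomaTasaki1994, §1] -/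
theorem hoppingFloor_of_ownSlot_orbitLower_of_diagHop_le {s U κ : ℝ} (Uo v : ℝ) (hκ : κ ≤ 2 * s)
    (h : ∀ (ω : InfVolFermionState 2) (Ls : ℕ → ℕ) (ψ : ∀ L, Fock (Orb (FermionTorus 2 L))),
      Tendsto Ls atTop atTop →
      (∀ j, IsGroundStateInSector (hubbardTorusTT' (Ls j) 1 s U) (rectN n (Ls j)) 0 (ψ (Ls j))) →
      (∀ j, star (ψ (Ls j)) ⬝ᵥ ψ (Ls j) = 1) → ω.IsTorusLimitOf ψ Ls →
      v ≤ ((Finset.univ : Finset (DihedralGroup 4)).card : ℝ)⁻¹ * ∑ g ∈ (Finset.univ : Finset (DihedralGroup 4)),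
        (ω.expect (d4ShiftSet g 0 (box 2 7)) (fermionEmbed (PolySite.d4Emb g 0 (box 2 7)) (-oddMomentObsTT s Uo 0))).re)
    {A : ℝ}
    (hA : ∀ (ω : InfVolFermionState 2) (Ls : ℕ → ℕ) (ψ : ∀ L, Fock (Orb (FermionTorus 2 L))),
      Tendsto Ls atTop atTop →
      (∀ j, IsGroundStateInSector (hubbardTorusTT' (Ls j) 1 s U) (rectN n (Ls j)) 0 (ψ (Ls j))) →
      (∀ j, star (ψ (Ls j)) ⬝ᵥ ψ (Ls j) = 1) → ω.IsTorusLimitOf ψ Ls →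
      ω.meanEnergy (hubbardTTPrimeFermionInteraction 0 1 0) 1 ≤ A) :
    ∀ (ω : InfVolFermionState 2) (Ls : ℕ → ℕ) (ψ : ∀ L, Fock (Orb (FermionTorus 2 L))),
      Tendsto Ls atTop atTop →
      (∀ j, IsGroundStateInSector (hubbardTorusTT' (Ls j) 1 s U) (rectN n (Ls j)) 0 (ψ (Ls j))) →
      (∀ j, star (ψ (Ls j)) ⬝ᵥ ψ (Ls j) = 1) → ω.IsTorusLimitOf ψ Ls →
      4 * v + (κ - 2 * s) * A ≤ ω.meanEnergy (hubbardTTPrimeFermionInteraction 1 κ 0) 1 := by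
  intro ω Ls ψ hLs hψ h1 hω
  have hv := h ω Ls ψ hLs hψ h1 hω
  rw [orbitMean_re_expect_neg_oddMomentTT_lam_zero hω.isTranslationInvariant] at hv
  have hcmp := InfVolFermionState.meanEnergy_hopping_le_add_mul_of_diagHop_le ω 1 (κ := κ) (κ' := 2 * s) hκ
    (hA ω Ls ψ hLs hψ h1 hω)
  linarith

/-- **WEIGHTED BRACKET, «own-word-and-CEILING × own-word-and-floor» edition.** Left floor = the class `(s₁, U₁, n)`'s OWN f-sum orbit-lower family `v₁` at the slot `s₁` plus a
CEILING `K₂ ≤ A₁` on it, used BEYOND the slot: orientation `κ₁ ≤ 2s₁` (i.e. the target lies left of the line of apex hopping `2s₁` through `A₁`); right floor = the class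
`(s₂, U₂, n)`'s own family `v₂` plus a floor `B₂ ≤ K₂`, orientation `2s₂ ≤ κ₂`. Then `ObsStiffnessSeqCeilingAt t′_P U_P n c` for every
`c ≥ μ₁(−v₁ − (κ₁ − 2s₁)A₁/4) + μ₂(−v₂ − (κ₂ − 2s₂)B₂/4)` (both prices `≥ 0`). With `A₁` the kinematic ceiling this words targets whose left source's END reads do not reach the needed
slot (`forall_torusLimit_diagHop_le_kinematic`, `Observables/StiffnessApexTransportFanTwoSided`). [cite: KomaTasaki1994, §1] [cite: ScalapinoWhiteZhang1993, §II] -/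
theorem ObsStiffnessSeqCeilingAt_of_two_apexSources_weighted_of_fsumCeil_fsumFloor (Uo₁ Uo₂ : ℝ) (hU₁0 : 0 ≤ U₁) (hU₁ : U₁ < UP)
    (hU₂0 : 0 ≤ U₂) (hU₂ : U₂ < UP) (hn0 : 0 ≤ n) (hn2 : n < 2) {μ₁ μ₂ : ℝ} (hμ₁ : 0 ≤ μ₁) (hμ₂ : 0 ≤ μ₂) (hμ : μ₁ + μ₂ = 1)
    (hκ : μ₁ * ((UP * s₁ - U₁ * t'P) / (UP - U₁)) + μ₂ * ((UP * s₂ - U₂ * t'P) / (UP - U₂)) = 2 * t'P)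
    (h2s₁ : (UP * s₁ - U₁ * t'P) / (UP - U₁) ≤ 2 * s₁) (h2s₂ : 2 * s₂ ≤ (UP * s₂ - U₂ * t'P) / (UP - U₂)) {v₁ v₂ : ℝ}
    (h₁ : ∀ (ω : InfVolFermionState 2) (Ls : ℕ → ℕ) (ψ : ∀ L, Fock (Orb (FermionTorus 2 L))),
      Tendsto Ls atTop atTop →
      (∀ j, IsGroundStateInSector (hubbardTorusTT' (Ls j) 1 s₁ U₁) (rectN n (Ls j)) 0 (ψ (Ls j))) →
      (∀ j, star (ψ (Ls j)) ⬝ᵥ ψ (Ls j) = 1) → ω.IsTorusLimitOf ψ Ls →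
      v₁ ≤ ((Finset.univ : Finset (DihedralGroup 4)).card : ℝ)⁻¹ * ∑ g ∈ (Finset.univ : Finset (DihedralGroup 4)),
        (ω.expect (d4ShiftSet g 0 (box 2 7)) (fermionEmbed (PolySite.d4Emb g 0 (box 2 7)) (-oddMomentObsTT s₁ Uo₁ 0))).re)
    {A₁ : ℝ}
    (hA₁ : ∀ (ω : InfVolFermionState 2) (Ls : ℕ → ℕ) (ψ : ∀ L, Fock (Orb (FermionTorus 2 L))),
      Tendsto Ls atTop atTop →
      (∀ j, IsGroundStateInSector (hubbardTorusTT' (Ls j) 1 s₁ U₁) (rectN n (Ls j)) 0 (ψ (Ls j))) →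
      (∀ j, star (ψ (Ls j)) ⬝ᵥ ψ (Ls j) = 1) → ω.IsTorusLimitOf ψ Ls →
      ω.meanEnergy (hubbardTTPrimeFermionInteraction 0 1 0) 1 ≤ A₁)
    (h₂ : ∀ (ω : InfVolFermionState 2) (Ls : ℕ → ℕ) (ψ : ∀ L, Fock (Orb (FermionTorus 2 L))),
      Tendsto Ls atTop atTop →
      (∀ j, IsGroundStateInSector (hubbardTorusTT' (Ls j) 1 s₂ U₂) (rectN n (Ls j)) 0 (ψ (Ls j))) →
      (∀ j, star (ψ (Ls j)) ⬝ᵥ ψ (Ls j) = 1) → ω.IsTorusLimitOf ψ Ls →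
      v₂ ≤ ((Finset.univ : Finset (DihedralGroup 4)).card : ℝ)⁻¹ * ∑ g ∈ (Finset.univ : Finset (DihedralGroup 4)),
        (ω.expect (d4ShiftSet g 0 (box 2 7)) (fermionEmbed (PolySite.d4Emb g 0 (box 2 7)) (-oddMomentObsTT s₂ Uo₂ 0))).re)
    {B₂ : ℝ}
    (hB₂ : ∀ (ω : InfVolFermionState 2) (Ls : ℕ → ℕ) (ψ : ∀ L, Fock (Orb (FermionTorus 2 L))),
      Tendsto Ls atTop atTop →
      (∀ j, IsGroundStateInSector (hubbardTorusTT' (Ls j) 1 s₂ U₂) (rectN n (Ls j)) 0 (ψ (Ls j))) →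
      (∀ j, star (ψ (Ls j)) ⬝ᵥ ψ (Ls j) = 1) → ω.IsTorusLimitOf ψ Ls →
      B₂ ≤ ω.meanEnergy (hubbardTTPrimeFermionInteraction 0 1 0) 1)
    (c : ℚ) (hc : μ₁ * (-v₁ - ((UP * s₁ - U₁ * t'P) / (UP - U₁) - 2 * s₁) * A₁ / 4) +
      μ₂ * (-v₂ - ((UP * s₂ - U₂ * t'P) / (UP - U₂) - 2 * s₂) * B₂ / 4) ≤ ((c : ℚ) : ℝ)) :
    ObsStiffnessSeqCeilingAt t'P UP n c :=
  ObsStiffnessSeqCeilingAt_of_two_apexSources_weighted hU₁0 hU₁ hU₂0 hU₂ hn0 hn2 hμ₁ hμ₂ hμ hκ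
    (hoppingFloor_of_ownSlot_orbitLower_of_diagHop_le Uo₁ v₁ h2s₁ h₁ hA₁)
    (hoppingFloor_of_ownSlot_orbitLower_of_le_diagHop Uo₂ v₂ h2s₂ h₂ hB₂) c (by
      have e : -(μ₁ * (4 * v₁ + ((UP * s₁ - U₁ * t'P) / (UP - U₁) - 2 * s₁) * A₁) +
            μ₂ * (4 * v₂ + ((UP * s₂ - U₂ * t'P) / (UP - U₂) - 2 * s₂) * B₂)) / 4 =
          μ₁ * (-v₁ - ((UP * s₁ - U₁ * t'P) / (UP - U₁) - 2 * s₁) * A₁ / 4) +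
            μ₂ * (-v₂ - ((UP * s₂ - U₂ * t'P) / (UP - U₂) - 2 * s₂) * B₂ / 4) := by ring
      rw [e]; exact hc)

end CeilingOrientation

end Summit.Ventures.CertifiedManyBodySolver.Observables

end
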